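import Summits.RiemannHypothesis.RiemannHypothesis.Theses.SpectralTrace
import Literature.NumberTheory.LFunctions.WeilArchimedeanPositivityProofs
import Literature.NumberTheory.LFunctions.WeilArchimedeanMoments
import Literature.NumberTheory.LFunctions.WeilMellinBounds
import Literature.Analysis.SpecialFunctions.DigammaGauss
import Literature.Analysis.SpecialFunctions.DigammaVerticalSeries
import HarnessLib

/-!
# `WindowTraceArch` — tools for the local Weyl law of window families

Support lemmas for the crux `stmt-RiemannHypothesis-11195`
(`Summit.RiemannHypothesis.RiemannHypothesis.Theses.SpectralTrace.WindowTraceArch`), recorded by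
the standing disprover (`Cruxes/WindowTraceArch/Disproof.lean` §2d). Every real family `γ`
reproducing the Weil functional on the Weil tests supported in `[-A, A]` (`A > 0`) obeys

* `card_near_le_log_of_windowTrace` : `#{i ∈ s : |γ_i - T| ≤ 1} ≤ C (1 + log(1 + |T|))` for
  every finset `s` of such indices, with `C = C(min(A, log 2))` — UNIFORM in `A ≥ log 2`;
* `finite_near_of_windowTrace` : the unit windows `{i : |γ_i - T| ≤ 1}` are finite sets with
  `ncard ≤ C (1 + log(1 + |T|))`;
* `finite_abs_le_of_windowTrace` : LOCAL FINITENESS, `{i : |γ_i| ≤ R}` is finite for all `R`;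
* the `log 2` specialisations for `WindowTraceArch` witnesses.

Method: test the identity against the modulated autocorrelation `h_T ⋆ h̃_T`,
`h_T(t) = e^{-iTt} h(t)`, of a narrow bump (`exists_bump_lower`: `|ĥ(1/2+iv)|² ≥ c > 0` on
`|v| ≤ 1`; `weilMellin_modulate`: `ĥ_T(1/2+iu) = ĥ(1/2+i(u-T))`); the sum of the costs is
`Re Q(h_T)` (`weilMellin_weilConv_weilReflect_half`), which in Yoshida's analytic form
(`weilQuadratic_re_eq_weilArchQuadratic`, no prime enters below `log 2`) is bounded using the
Stirling-type bound `Re ψ(1/4 + iu/2) ≤ 5 + log(1 + |u|)` (`reDigammaQuarter_le_log`, from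
`re_digamma_le_log_norm_add` and `reDigammaQuarter_mono`) by
`2‖h‖²_{L¹,½} + K(h) + P(h)·log(1+|T|)`.

Together with `Negative/BoundedDensity.lean` (cells get arbitrarily crowded) this brackets the
local density of any witness between "unbounded" and `O(log T)` — the two halves of the
Riemann–von Mangoldt shape, with no arithmetic input. The upper bound is also the local
finiteness that an operator packaging (`SpectralPackaging`) or a vague-limit argument
(`WindowCompactness`) of the route would need, uniform in the window.
-/

noncomputable section

open Complex Set MeasureTheory Filter
open scoped Real Topology ContDiff ComplexConjugate

namespace Summit.RiemannHypothesis.RiemannHypothesis.Theorems.WindowTraceArch.Negative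

open Literature.NumberTheory.LFunctions
open Literature.Analysis.SpecialFunctions

/-! ### An upper bound for the archimedean weight `Re ψ(1/4 + iu/2)` -/

/-- `Re ψ(1/4 + iu/2) ≤ 5 + log(1 + |u|)` for all real `u` (Stirling-type bound
`re_digamma_le_log_norm_add` for `|u| ≥ 1`, monotonicity `reDigammaQuarter_mono` below).
[folklore] -/
theorem reDigammaQuarter_le_log (u : ℝ) :
    reDigammaQuarter u ≤ 5 + Real.log (1 + |u|) := by
  -- the bound for `|u| ≥ 1`
  have key : ∀ u : ℝ, 1 ≤ |u| → reDigammaQuarter u ≤ 4 + Real.log (1 + |u|) := by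
    intro u hu
    set w : ℂ := 1 / 4 + u / 2 * I with hw
    have hre : w.re = 1 / 4 := by simp [hw]
    have him : w.im = u / 2 := by simp [hw]
    have hw0 : 0 < w.re := by rw [hre]; norm_num
    have hwi : w.im ≠ 0 := by
      rw [him]
      intro h0
      have : u = 0 := by linarith
      rw [this, abs_zero] at hu
      linarith
    have h := Literature.Analysis.SpecialFunctions.Complex.re_digamma_le_log_norm_add hw0 hwi
    -- `‖w‖ ≤ 1 + |u|`, `‖w‖ ≥ |u|/2 ≥ 1/2`
    have hn1 : ‖w‖ ≤ 1 + |u| := by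
      calc ‖w‖ ≤ ‖(1 / 4 : ℂ)‖ + ‖(u / 2 : ℂ) * I‖ := norm_add_le _ _
        _ = 1 / 4 + |u| / 2 := by
            rw [norm_mul, Complex.norm_I, mul_one]
            have : ((u : ℂ) / 2) = ((u / 2 : ℝ) : ℂ) := by push_cast; ring
            rw [this, Complex.norm_real, Real.norm_eq_abs, abs_div, abs_two]
            norm_num
        _ ≤ 1 + |u| := by linarith [abs_nonneg u]
    have hn2 : |u| / 2 ≤ ‖w‖ := by
      have := Complex.abs_im_le_norm w
      rw [him, abs_div, abs_two] at this
      exact this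
    have hnpos : 0 < ‖w‖ := by linarith
    have hlog : Real.log ‖w‖ ≤ Real.log (1 + |u|) := Real.log_le_log hnpos hn1
    have h2 : 1 / (2 * ‖w‖ ^ 2) ≤ 2 := by
      rw [div_le_iff₀ (by positivity)]
      nlinarith
    have h3 : π / (4 * |w.im|) ≤ 2 := by
      rw [him, abs_div, abs_two, div_le_iff₀ (by positivity)]
      nlinarith [Real.pi_lt_d2]
    have : reDigammaQuarter u = (Complex.digamma w).re := rfl
    linarith
  rcases le_or_gt 1 |u| with hu | hu
  · linarith [key u hu]
  · have hmono : reDigammaQuarter u ≤ reDigammaQuarter 1 :=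
      reDigammaQuarter_mono (by rw [abs_one]; exact hu.le)
    have h1 := key 1 (by rw [abs_one])
    rw [abs_one] at h1
    have hlog2 : Real.log (1 + 1) ≤ 1 := by
      rw [one_add_one_eq_two]
      linarith [Real.log_two_lt_d9]
    have hlog0 : 0 ≤ Real.log (1 + |u|) := Real.log_nonneg (by linarith [abs_nonneg u])
    linarith

/-! ### A narrow non-negative bump and a lower bound for its transform near the origin -/

/-- For `0 < δ ≤ 1/2` there is a Weil test `h` supported in `[-δ, δ]`, bounded by `1`, and a
constant `c > 0` with `c ≤ |ĥ(1/2 + iv)|²` for all `|v| ≤ 1` (a smooth bump at `0`: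
`Re ĥ(1/2+iv) = ∫ h(t) cos(vt) dt ≥ cos(1/2) ∫ h` since `|vt| ≤ 1/2`). [folklore] -/
theorem exists_bump_lower {δ : ℝ} (hδ : 0 < δ) (hδ1 : δ ≤ 1 / 2) :
    ∃ h : ℝ → ℂ, IsWeilTest h ∧ tsupport h ⊆ Icc (-δ) δ ∧ (∀ t, ‖h t‖ ≤ 1) ∧
      ∃ c : ℝ, 0 < c ∧ ∀ v : ℝ, |v| ≤ 1 → c ≤ ‖weilMellin h (1 / 2 + v * I)‖ ^ 2 := by
  let b : ContDiffBump (0 : ℝ) := ⟨δ / 2, δ, by positivity, by linarith⟩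
  set h : ℝ → ℂ := fun t => ((b t : ℝ) : ℂ) with hh_def
  have hh : IsWeilTest h :=
    ⟨Complex.ofRealCLM.contDiff.comp b.contDiff, b.hasCompactSupport.comp_left Complex.ofReal_zero⟩
  have hsupp : tsupport h ⊆ Icc (-δ) δ := by
    refine (tsupport_comp_subset Complex.ofReal_zero _).trans ?_
    rw [b.tsupport_eq, Real.closedBall_eq_Icc, zero_sub, zero_add]
  have hle1 : ∀ t, ‖h t‖ ≤ 1 := fun t => by
    simp only [hh_def, Complex.norm_real, Real.norm_eq_abs, abs_of_nonneg (b.nonneg)]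
    exact b.le_one
  set m : ℝ := ∫ t, b t with hm
  have hmpos : 0 < m := b.integral_pos
  have hcos : 0 < Real.cos (1 / 2) :=
    Real.cos_pos_of_mem_Ioo ⟨by linarith [Real.pi_gt_three], by linarith [Real.pi_gt_three]⟩
  refine ⟨h, hh, hsupp, hle1, (Real.cos (1 / 2) * m) ^ 2, by positivity, fun v hv => ?_⟩
  -- `Re ĥ(1/2+iv) = ∫ b(t) cos(vt) dt ≥ cos(1/2) · m`
  have hint : Integrable fun t : ℝ => h t * cexp ((1 / 2 + v * I - 1 / 2) * t) :=
    integrable_weilIntegrand hh.1.continuous hh.2 _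
  have hre : (weilMellin h (1 / 2 + v * I)).re = ∫ t, b t * Real.cos (v * t) := by
    unfold weilMellin
    have hre' := integral_re hint
    simp only [RCLike.re_to_complex] at hre'
    rw [← hre']
    refine integral_congr_ae (Eventually.of_forall fun t => ?_)
    have e : (1 / 2 + (v : ℂ) * I - 1 / 2) * (t : ℂ) = ((v * t : ℝ) : ℂ) * I := by
      push_cast; ring
    simp only [hh_def]
    rw [e, Complex.re_ofReal_mul, Complex.exp_ofReal_mul_I_re]
  have hlow : Real.cos (1 / 2) * m ≤ (weilMellin h (1 / 2 + v * I)).re := by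
    rw [hre, hm, ← integral_const_mul]
    refine integral_mono ((b.continuous.integrable_of_hasCompactSupport
      b.hasCompactSupport).const_mul _) ?_ fun t => ?_
    · exact (b.continuous.mul (by fun_prop)).integrable_of_hasCompactSupport
        b.hasCompactSupport.mul_right
    · by_cases ht : b t = 0
      · simp [ht]
      · have hts : t ∈ Function.support b := ht
        rw [b.support_eq, Metric.mem_ball, dist_zero_right, Real.norm_eq_abs] at hts
        have hvt : |v * t| ≤ 1 / 2 := by
          rw [abs_mul]
          nlinarith [abs_nonneg v, abs_nonneg t]
        have hc : Real.cos (1 / 2) ≤ Real.cos (v * t) := by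
          rw [← Real.cos_abs (v * t)]
          exact Real.cos_le_cos_of_nonneg_of_le_pi (abs_nonneg _)
            (by linarith [Real.pi_gt_three]) hvt
        rw [mul_comm]
        exact mul_le_mul_of_nonneg_left hc b.nonneg
  have hre_le : (weilMellin h (1 / 2 + v * I)).re ≤ ‖weilMellin h (1 / 2 + v * I)‖ :=
    Complex.re_le_norm _
  have h0 : 0 ≤ Real.cos (1 / 2) * m := by positivity
  nlinarith

/-! ### Modulation `h_T(t) = e^{-iTt} h(t)` -/

/-- Modulated test functions are test functions. [folklore] -/
theorem isWeilTest_modulate {h : ℝ → ℂ} (hh : IsWeilTest h) (T : ℝ) :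
    IsWeilTest fun t : ℝ => cexp (-((T * t : ℝ) : ℂ) * I) * h t := by
  refine ⟨ContDiff.mul ?_ hh.1, hh.2.mul_left⟩
  have h1 : ContDiff ℝ ∞ fun t : ℝ => -((T * t : ℝ) : ℂ) * I :=
    ((Complex.ofRealCLM.contDiff.comp (contDiff_const.mul contDiff_id)).neg.mul contDiff_const)
  exact Complex.contDiff_exp.comp h1

/-- Modulation does not enlarge the support. [folklore] -/
theorem tsupport_modulate_subset (h : ℝ → ℂ) (T : ℝ) :
    tsupport (fun t : ℝ => cexp (-((T * t : ℝ) : ℂ) * I) * h t) ⊆ tsupport h :=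
  tsupport_mul_subset_right

/-- Modulation has modulus one pointwise. [folklore] -/
theorem norm_modulate (h : ℝ → ℂ) (T t : ℝ) :
    ‖cexp (-((T * t : ℝ) : ℂ) * I) * h t‖ = ‖h t‖ := by
  rw [norm_mul, show -((T * t : ℝ) : ℂ) * I = ((-(T * t) : ℝ) : ℂ) * I by push_cast; ring,
    Complex.norm_exp_ofReal_mul_I, one_mul]

/-- **Modulation shifts the transform**: `(e^{-iT·} h)^(1/2 + iu) = ĥ(1/2 + i(u - T))`.
[folklore] -/
theorem weilMellin_modulate (h : ℝ → ℂ) (T u : ℝ) :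
    weilMellin (fun t : ℝ => cexp (-((T * t : ℝ) : ℂ) * I) * h t) (1 / 2 + u * I) =
      weilMellin h (1 / 2 + ((u - T : ℝ) : ℂ) * I) := by
  unfold weilMellin
  refine integral_congr_ae (Eventually.of_forall fun t => ?_)
  simp only
  rw [mul_comm (cexp _) (h t), mul_assoc, ← Complex.exp_add]
  congr 2
  push_cast
  ring

end Summit.RiemannHypothesis.RiemannHypothesis.Theorems.WindowTraceArch.Negative

end
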